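import Mathlib.Analysis.Complex.ExponentialBounds
import Literature.Computability.AlgebraicComplexity.Forbes15SupportBound
import HarnessLib

/-!
# Forbes 2015, Prop. 6.5 (`m = 1`) — the support bound with a constant linear in `t`

M. A. Forbes, *Deterministic divisibility testing via shifted partial derivatives*, FOCS 2015
(doi:10.1109/FOCS.2015.35; held `paper:doi-10-1109-focs-2015-35`), Prop. 6.5: «In particular, for
`m = O(1)`, `‖a‖₀ ≤ O(t ln s)`» (print: `‖a‖₀ ≤ 2e³(t+1)(ln s + m ln(2m) + 1)`, Lemma A.6).

`Forbes15SupportBound.card_lt_of_isTrailing` proves `n < 9(t+2)3^t·(⌊log₂ s⌋+1)` in `ℕ` only; this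
file sharpens the constant to one LINEAR in `t`, `n < 33(t+2)·(⌊log₂ s⌋+1)`, matching the shape of
the printed `O(t log s)`, at the price of one real-analytic estimate `(1 + 2/t)^t ≤ e² < 8`
(Forbes: `(1 + 1/t)^t ≤ e`, proof of Lemma A.3).  All theorems.
-/

open Finset

namespace Literature.Computability.AlgebraicComplexity.Forbes15

/-- `(t+2)^t ≤ 8·t^t`, i.e. `(1 + 2/t)^t ≤ e² < 8` (Forbes, proof of Lemma A.3: «using that
`1 + x ≤ e^x`»). [cite: Forbes2015, Lemma A.3 (proof)] -/
theorem add_two_pow_le_eight_mul (t : ℕ) : (t + 2) ^ t ≤ 8 * t ^ t := by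
  rcases Nat.eq_zero_or_pos t with rfl | ht
  · simp
  · have htR : (0 : ℝ) < t := by exact_mod_cast ht
    have h1 : (1 + 2 / (t : ℝ)) ≤ Real.exp (2 / t) := by
      have := Real.add_one_le_exp (2 / (t : ℝ)); linarith
    have h2 : (1 + 2 / (t : ℝ)) ^ t ≤ Real.exp 2 := by
      calc (1 + 2 / (t : ℝ)) ^ t ≤ Real.exp (2 / t) ^ t :=
            pow_le_pow_left₀ (by positivity) h1 t
        _ = Real.exp (t * (2 / t)) := (Real.exp_nat_mul _ _).symm
        _ = Real.exp 2 := by rw [mul_div_cancel₀ _ htR.ne']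
    have h3 : Real.exp 2 < 8 := by
      have h := Real.exp_one_lt_d9
      have : Real.exp 2 = Real.exp 1 * Real.exp 1 := by rw [← Real.exp_add]; norm_num
      rw [this]
      nlinarith [Real.exp_pos 1]
    have h4 : ((t + 2 : ℕ) : ℝ) ^ t = (t : ℝ) ^ t * (1 + 2 / (t : ℝ)) ^ t := by
      rw [← mul_pow]
      congr 1
      push_cast
      field_simp
    have h5 : ((t + 2 : ℕ) : ℝ) ^ t ≤ 8 * (t : ℝ) ^ t := by
      rw [h4]
      calc (t : ℝ) ^ t * (1 + 2 / (t : ℝ)) ^ t ≤ (t : ℝ) ^ t * 8 :=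
            mul_le_mul_of_nonneg_left (h2.trans h3.le) (by positivity)
        _ = 8 * (t : ℝ) ^ t := by ring
    exact_mod_cast h5

/-- **The parameter choice with a linear constant** (`ℓ = tn`, `n ≥ 33(t+2)·k`):
`4^k·k^k·(n+tk+tn)^{(t+1)k} ≤ n^k·(tn+1)^{tk}·(n−k+1)^k`. [cite: Forbes2015, Lemma A.6] -/
theorem key_estimate_linear {n k t : ℕ} (hn : 33 * (t + 2) * k ≤ n) :
    4 ^ k * k ^ k * (n + (t * k + t * n)) ^ ((t + 1) * k) ≤
      n ^ k * (t * n + 1) ^ (t * k) * (n - k + 1) ^ k := by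
  have htk : t * k ≤ n := le_trans (Nat.mul_le_mul_right k (by nlinarith)) hn
  have base : 4 * k * (n + (t * k + t * n)) ^ (t + 1) ≤ n * (t * n + 1) ^ t * (n - k + 1) := by
    have s1 : n + (t * k + t * n) ≤ (t + 2) * n := by nlinarith
    have s2 : (n + (t * k + t * n)) ^ (t + 1) ≤ (t + 2) ^ (t + 1) * n ^ (t + 1) := by
      rw [← mul_pow]; exact Nat.pow_le_pow_left s1 _
    have s3 : 32 * k * (t + 2) ≤ n - k + 1 := by
      have : 32 * k * (t + 2) + k ≤ 33 * (t + 2) * k := by nlinarith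
      omega
    have s4 : (t * n) ^ t ≤ (t * n + 1) ^ t := Nat.pow_le_pow_left (Nat.le_succ _) t
    calc 4 * k * (n + (t * k + t * n)) ^ (t + 1)
        ≤ 4 * k * ((t + 2) ^ (t + 1) * n ^ (t + 1)) := Nat.mul_le_mul_left _ s2
      _ = (4 * k * (t + 2)) * (t + 2) ^ t * n ^ (t + 1) := by ring
      _ ≤ (4 * k * (t + 2)) * (8 * t ^ t) * n ^ (t + 1) :=
          Nat.mul_le_mul_right _ (Nat.mul_le_mul_left _ (add_two_pow_le_eight_mul t))
      _ = (32 * k * (t + 2)) * (t ^ t * n ^ (t + 1)) := by ring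
      _ ≤ (n - k + 1) * (t ^ t * n ^ (t + 1)) := Nat.mul_le_mul_right _ s3
      _ = n * (t * n) ^ t * (n - k + 1) := by ring
      _ ≤ n * (t * n + 1) ^ t * (n - k + 1) :=
          Nat.mul_le_mul_right _ (Nat.mul_le_mul_left _ s4)
  have := Nat.pow_le_pow_left base k
  calc 4 ^ k * k ^ k * (n + (t * k + t * n)) ^ ((t + 1) * k)
      = (4 * k * (n + (t * k + t * n)) ^ (t + 1)) ^ k := by
        rw [mul_pow, mul_pow, ← pow_mul]
    _ ≤ (n * (t * n + 1) ^ t * (n - k + 1)) ^ k := this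
    _ = n ^ k * (t * n + 1) ^ (t * k) * (n - k + 1) ^ k := by
        rw [mul_pow, mul_pow, ← pow_mul]

/-- **From the measure inequality to a bound linear in `t`:** `n < 33(t+2)·(⌊log₂ s⌋+1)`.
[cite: Forbes2015, Prop. 6.5 / Lemma A.6 («n ≤ 2e³t(ln s + m ln 2m + 1)»)] -/
theorem lt_of_measureIneq_linear {n t s : ℕ}
    (h : ∀ k ℓ : ℕ, k ≤ n →
      n.choose k * (n - k + ℓ).choose ℓ ≤ s * (k + 1) * (n + (t * k + ℓ)).choose (t * k + ℓ)) :
    n < 33 * (t + 2) * (Nat.log 2 s + 1) := by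
  by_contra hcon
  push Not at hcon
  set k := Nat.log 2 s + 1 with hk
  have hs : s < 2 ^ k := Nat.lt_pow_succ_log_self (by norm_num) s
  have hk1 : 1 ≤ k := by omega
  have hkn : k ≤ n := le_trans (Nat.le_mul_of_pos_left k (by positivity)) hcon
  have hn1 : 1 ≤ n := hk1.trans hkn
  have h1 := measureIneq_expand hkn (h k (t * n) hkn)
  have h2 := key_estimate_linear hcon
  have hk2 : k + 1 ≤ 2 ^ k := Nat.succ_le_of_lt k.lt_two_pow_self
  have hX : 0 < k ^ k * (n + (t * k + t * n)) ^ ((t + 1) * k) := by positivity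
  have h3 : s * (k + 1) * k ^ k * (n + (t * k + t * n)) ^ ((t + 1) * k) <
      4 ^ k * k ^ k * (n + (t * k + t * n)) ^ ((t + 1) * k) := by
    have h4 : s * (k + 1) < 2 ^ k * 2 ^ k :=
      lt_of_lt_of_le (Nat.mul_lt_mul_of_lt_of_le hs le_rfl (by omega))
        (Nat.mul_le_mul_left _ hk2)
    have h5 : (4 : ℕ) ^ k = 2 ^ k * 2 ^ k := by
      rw [← mul_pow]; norm_num
    rw [h5, mul_assoc (s * (k + 1)), mul_assoc (2 ^ k * 2 ^ k)]
    exact Nat.mul_lt_mul_of_lt_of_le h4 le_rfl hX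
  exact absurd (h1.trans_lt h3) (not_lt.mpr h2)

variable {F Λ : Type*} [Field F] [AddCommMonoid Λ] [LinearOrder Λ] [IsOrderedCancelAddMonoid Λ]

/-- **Forbes 2015, Prop. 6.5 (`m = 1`), core form with a constant linear in `t`:** under the
hypotheses of `card_lt_of_isTrailing`, `n < 33(t+2)·(⌊log₂ s⌋+1)` (print: `O(t ln s)`).
[cite: Forbes2015, Prop. 6.5] -/
theorem card_lt_of_isTrailing_linear {n s t : ℕ} {r : (Fin n →₀ ℕ) →+ Λ}
    (hr : Function.Injective r) (hmono : Monotone r) {α : Fin n → F} (hα : ∀ i, α i ≠ 0)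
    {u G : Fin s → MvPolynomial (Fin n) F} {d : Fin s → ℕ} (hu : ∀ i, LogAffine α (u i))
    (hG : ∀ i, (G i).totalDegree ≤ t) {a : Fin n →₀ ℕ}
    (hg : IsTrailing r (∑ i, u i * G i ^ d i) a) (ha : ∀ i, (a i : F) ≠ 0) :
    n < 33 * (t + 2) * (Nat.log 2 s + 1) :=
  lt_of_measureIneq_linear fun k ℓ _ => choose_mul_choose_le hr hmono hα hu hG hg ha k ℓ

end Literature.Computability.AlgebraicComplexity.Forbes15
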